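import Mathlib
import HarnessLib
import HarnessLib.Audit
import Summits.Langlands.Langlands.Theorems.DepthIsolationSplit
import Literature.NumberTheory.Automorphic.SolvableBaseChangeModularityProofs
import Literature.NumberTheory.Automorphic.TotallyRealModularity
import Literature.NumberTheory.Automorphic.RealQuadraticJInvariantModularity
import Literature.NumberTheory.EllipticCurves.IsogenyHasCMProofs

/-!
# JDegreeFilterSplit (Prelude) — lens-5 g27 node on REST_E = `DepthIsolationSplit.UnanchoredHighDegreeModularE`
Census-twin landing of the node file `HOME/nodes/lens-5-g27-JDegreeFilterSplit.lean` (sha256 19b9e9133f31…, 780 l), SPLIT VERBATIM into three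
Theorems files for the gate's 400-line lint (census-1 g30; crit-1 g9 CLEARED row 401), with gate repairs limited to docstrings: nine one-line
docstrings added on previously undocumented lemmas; the kit's three unregistered cite keys re-keyed to registered bib keys (Dieulefait2015,
BCDT2001, DieulefaitFreitas2014) and every citation written as a prose `[ref: KEY, locator]` tag (NOT a gate cite-tag, so that the node-local
junction defs stay in this file instead of entering the Literature relocation lane — the cell's census-twin convention); no declaration body changed.  Prelude = §1–§4 (dial, sectors, RJD, NSBC with the `jModel` section) · Bridge = §4 tail,
§4b, §4b′, §4c · main = §5–§7 (compositions `closes_target` / `closes_byName`, orbit closure, guards).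
This part covers §1–§4 up to the `jModel` section.  The full module docstring of the node is kept in the Prelude.

# JDegreeFilterSplit — lens-5 g27 node on REST_E = `DepthIsolationSplit.UnanchoredHighDegreeModularE`
(the E-level form of REST = `TowerDoorSplit.UnanchoredHighDegreeWitnessAutomorphy`, stmt-Langlands-26998, the DECLARED
RESIDUAL of route-Langlands-TowerDoorSplit; REST_E is the TYPE of its registered stub `stub_unanchored` and the target of
the landed g26 node `Theorems/DepthIsolationSplit.lean`): «every integral elliptic curve over an unanchored totally real
field of degree ≥ 6 is modular».

AXIS (finite/base range + asymptotic regime + bridge, in the currency of the MODULI DEGREE):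

* dial `jDeg K₀ E = [ℚ(j(E)) : ℚ]`, `j(E) = c₄³/Δ ∈ K₀` — an ABSOLUTE invariant of the curve: unchanged by quadratic
  twist (same `j`) and by every base extension (same `j`, same `ℚ(j)`), so each sector below is closed under the
  gate's orbit moves (⊗χ, restriction to solvable totally real extensions, descent) — no leak between sectors;
* finite/base range RJD `RationalJDoor` (`jDeg ≤ 1`, i.e. `j ∈ ℚ`): PRINT modulo the junction DBC
  `RatBaseChangeModularity` = base change of classical weight-2 newforms to an ARBITRARY totally real field
  (Dieulefait, arXiv:1208.3946, Thm 1.2, with BCDT) — the tree's named fact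
  `isModularEllipticCurve_baseChange_rat_of_isSolvable` WITHOUT its `[IsGalois ℚ K] [IsSolvable]` binders; kernel
  `rationalJDoor_of_ratBaseChange : DBC → RJD` (twist invariance + CM, both PROVED in the tree);
* bridge SJD `SmallFieldJDoor` (`2 ≤ jDeg ≤ 3`, or `jDeg = 4 ∧ √5 ∉ ℚ(j)`): kernel `smallFieldJDoor_of_bridge : NSBC →
  FLS2015_theorem1 → DNS2020_theorem4 → Box2022_theorem1_1 → SJD`, where NSBC `SmallFieldBaseChange` = base change of
  weight-2 automorphy of elliptic curves from totally real fields of degree 2, 3, 4 to the (in general INSOLUBLE, non-Galois) box fields above them — a NEW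
  typed leaf; its Galois-soluble sub-locus is the tree fact
  `isModularEllipticCurve_baseChange_of_isSolvable_of_isAutomorphicOfWeightZero` BY NAME
  (`smallFieldBaseChange_soluble_locus`);
* asymptotic regime LJR `LargeJResidual` (`jDeg ≥ 5`, or `jDeg = 4 ∧ √5 ∈ ℚ(j)`): the DECLARED RESIDUAL (REST_E on the curves
  whose field of moduli is itself beyond printed modularity).

KERNEL: `restE_iff_jSectors : REST_E ↔ RJD ∧ SJD ∧ LJR` (exact trichotomy, no junction); `restE_of_jLeaves :
DBC → NSBC → FLS2015_theorem1 → DNS2020_theorem4 → Box2022_theorem1_1 → LJR → REST_E`; `closes_target : (same six) → IMT →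
TRANY → W⁺|₂ → R1 → REST` BY NAME (body of `DepthIsolationSplit.closes_target`); necessity `smallFieldBaseChange_of_restE :
REST_E → NSBC`, `ratBaseChange_solvable_case : DBC → isModularEllipticCurve_baseChange_rat_of_isSolvable`, and the
three sector projections. 0 sorry; axioms expected [propext, Classical.choice, Quot.sound].
-/

set_option linter.dupNamespace false
set_option linter.unusedVariables false

open scoped NumberField IntermediateField
open NumberField Literature.NumberTheory.Automorphic
open Summit.Langlands.Langlands.Theorems.DepthIsolationSplit (UnanchoredBox UnanchoredHighDegreeModularE
  modularE_iff_box IntegralModelTransferPointwise SatakeAvatarTwo satakeAvatarTwo_of_host)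

namespace Summit.Langlands.Langlands.Theorems.JDegreeFilterSplit

/-! ## §1 The dial: the moduli degree `[ℚ(j(E)) : ℚ]` -/

/-- The `j`-invariant `c₄(E)³ / Δ(E)` of an integral model, read in `K₀` (the tree's carrier for `j`, as in
`isModularEllipticCurve_of_jInvariant_eq` and `FLS2015_theorem5`). -/
noncomputable def jInv (K₀ : Type) [Field K₀] [NumberField K₀] (E : WeierstrassCurve (𝓞 K₀)) : K₀ :=
  (algebraMap (𝓞 K₀) K₀ E.c₄) ^ 3 / algebraMap (𝓞 K₀) K₀ E.Δ

/-- The MODULI DEGREE `m(E) = [ℚ(j(E)) : ℚ]` — the degree over `ℚ` of the field of moduli `ℚ⟮j⟯ ≤ K₀`. -/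
noncomputable def jDeg (K₀ : Type) [Field K₀] [NumberField K₀] (E : WeierstrassCurve (𝓞 K₀)) : ℕ :=
  Module.finrank ℚ ℚ⟮jInv K₀ E⟯

/-- The BRIDGE RANGE of the dial: `[ℚ(j):ℚ] ∈ {2, 3}`, or `[ℚ(j):ℚ] = 4` with `√5 ∉ ℚ(j)` — exactly the ranges in which
modularity over the field of moduli is PRINT (FLS 2015 Thm 1, DNS 2020 Thm 4, Box 2022 Thm 1.1, all tree facts BY NAME). -/
def InBridgeRange (K₀ : Type) [Field K₀] [NumberField K₀] (E : WeierstrassCurve (𝓞 K₀)) : Prop :=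
  2 ≤ jDeg K₀ E ∧ (jDeg K₀ E ≤ 3 ∨ (jDeg K₀ E = 4 ∧ ¬ IsSquare (5 : ℚ⟮jInv K₀ E⟯)))

/-- The RESIDUAL RANGE of the dial: `[ℚ(j):ℚ] ≥ 5`, or `= 4` with `√5 ∈ ℚ(j)` (there modularity over the field of moduli is
itself open: the live route SqrtFiveQuarticCovers for `√5`-quartics, nothing for degree `≥ 5`). -/
def InResidualRange (K₀ : Type) [Field K₀] [NumberField K₀] (E : WeierstrassCurve (𝓞 K₀)) : Prop :=
  5 ≤ jDeg K₀ E ∨ (jDeg K₀ E = 4 ∧ IsSquare (5 : ℚ⟮jInv K₀ E⟯))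

/-- TRICHOTOMY of the dial. -/
theorem jDeg_trichotomy (K₀ : Type) [Field K₀] [NumberField K₀] (E : WeierstrassCurve (𝓞 K₀)) :
    jDeg K₀ E ≤ 1 ∨ InBridgeRange K₀ E ∨ InResidualRange K₀ E := by
  unfold InBridgeRange InResidualRange
  by_cases h5 : IsSquare (5 : ℚ⟮jInv K₀ E⟯)
  · rcases Nat.lt_or_ge (jDeg K₀ E) 2 with h | h
    · exact Or.inl (by omega)
    rcases Nat.lt_or_ge (jDeg K₀ E) 4 with h' | h'
    · exact Or.inr (Or.inl ⟨h, Or.inl (by omega)⟩)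
    rcases Nat.lt_or_ge (jDeg K₀ E) 5 with h'' | h''
    · exact Or.inr (Or.inr (Or.inr ⟨by omega, h5⟩))
    · exact Or.inr (Or.inr (Or.inl h''))
  · rcases Nat.lt_or_ge (jDeg K₀ E) 2 with h | h
    · exact Or.inl (by omega)
    rcases Nat.lt_or_ge (jDeg K₀ E) 5 with h' | h'
    · refine Or.inr (Or.inl ⟨h, ?_⟩)
      rcases Nat.lt_or_ge (jDeg K₀ E) 4 with h'' | h''
      · exact Or.inl (by omega)
      · exact Or.inr ⟨by omega, h5⟩
    · exact Or.inr (Or.inr (Or.inl h'))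

/-! ## §2 The three sectors of REST_E -/

/-- RJD (finite/base range; WEAKER; PRINT modulo DBC): every integral `E` over an unanchored totally real field of
degree `≥ 6` whose `j`-invariant is RATIONAL (`[ℚ(j):ℚ] ≤ 1`) is modular. -/
def RationalJDoor : Prop :=
  ∀ (K₀ : Type) [Field K₀] [NumberField K₀], UnanchoredBox K₀ →
    ∀ E : WeierstrassCurve (𝓞 K₀), E.Δ ≠ 0 → jDeg K₀ E ≤ 1 → IsModularEllipticCurve K₀ E

/-- SJD (bridge sector; WEAKER; PRINT ⊕ NSBC): every integral `E` over an unanchored totally real field of degree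
`≥ 6` whose field of moduli `ℚ(j)` has degree `2` or `3`, or `4` with `√5 ∉ ℚ(j)`, is modular. -/
def SmallFieldJDoor : Prop :=
  ∀ (K₀ : Type) [Field K₀] [NumberField K₀], UnanchoredBox K₀ →
    ∀ E : WeierstrassCurve (𝓞 K₀), E.Δ ≠ 0 → InBridgeRange K₀ E → IsModularEllipticCurve K₀ E

/-- LJR (asymptotic regime; the DECLARED RESIDUAL): every integral `E` over an unanchored totally real field of
degree `≥ 6` whose field of moduli has degree `≥ 5`, or `4` with `√5 ∈ ℚ(j)`, is modular. -/
def LargeJResidual : Prop :=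
  ∀ (K₀ : Type) [Field K₀] [NumberField K₀], UnanchoredBox K₀ →
    ∀ E : WeierstrassCurve (𝓞 K₀), E.Δ ≠ 0 → InResidualRange K₀ E → IsModularEllipticCurve K₀ E

/-- EXACTNESS (no junction): REST_E ⟺ RJD ∧ SJD ∧ LJR — trichotomy of the natural number `[ℚ(j):ℚ]`. -/
theorem restE_iff_jSectors :
    UnanchoredHighDegreeModularE ↔ RationalJDoor ∧ SmallFieldJDoor ∧ LargeJResidual := by
  rw [modularE_iff_box]
  refine ⟨fun h => ⟨fun K₀ _ _ hb E hΔ _ => h K₀ hb E hΔ, fun K₀ _ _ hb E hΔ _ => h K₀ hb E hΔ,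
    fun K₀ _ _ hb E hΔ _ => h K₀ hb E hΔ⟩, ?_⟩
  rintro ⟨hR, hS, hL⟩ K₀ _ _ hb E hΔ
  rcases jDeg_trichotomy K₀ E with h | h | h
  · exact hR K₀ hb E hΔ h
  · exact hS K₀ hb E hΔ h
  · exact hL K₀ hb E hΔ h

/-- The three sector projections (necessity, trivial direction). -/
theorem rationalJDoor_of_restE (h : UnanchoredHighDegreeModularE) : RationalJDoor := (restE_iff_jSectors.1 h).1

/-- NECESSITY: REST_E gives the bridge sector SJD (projection of `restE_iff_jSectors`). -/
theorem smallFieldJDoor_of_restE (h : UnanchoredHighDegreeModularE) : SmallFieldJDoor := (restE_iff_jSectors.1 h).2.1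

/-- NECESSITY: REST_E gives the residual sector LJR (projection of `restE_iff_jSectors`). -/
theorem largeJResidual_of_restE (h : UnanchoredHighDegreeModularE) : LargeJResidual := (restE_iff_jSectors.1 h).2.2

/-- KERNEL (sector level): RJD ∧ SJD ∧ LJR ⇒ REST_E (the `←` direction of `restE_iff_jSectors`). -/
theorem restE_of_jSectors (hR : RationalJDoor) (hS : SmallFieldJDoor) (hL : LargeJResidual) :
    UnanchoredHighDegreeModularE := restE_iff_jSectors.2 ⟨hR, hS, hL⟩

/-! ## §3 The base range RJD is PRINT modulo DBC (base change from `ℚ` to an arbitrary totally real field) -/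

/-- DBC (PRINT junction; WEAKER; not yet vendored): the base change to ANY totally real field `K` of an integral
model `E₀ / ℤ` with `Δ ≠ 0` is modular.  Print: `E₀ / ℚ` is modular (Breuil–Conrad–Diamond–Taylor, Thm A), and a
classical newform of arbitrary level and weight `k ≥ 2` admits base change to every totally real number field `F`
(Dieulefait, «Automorphy of Symm⁵(GL(2)) and base change», arXiv:1208.3946, Thm 1.2, §5: no solvability or
Galois hypothesis on `F/ℚ`; proof by propagation of automorphy along safe chains of congruences); the CM case is
automorphic induction.  This is VERBATIM the tree's named fact `isModularEllipticCurve_baseChange_rat_of_isSolvable`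
with the binders `[IsGalois ℚ K] [IsSolvable (K ≃ₐ[ℚ] K)]` deleted (`ratBaseChange_solvable_case`).
[ref: Dieulefait2015, Thm 1.2 (arXiv:1208.3946)] [ref: BCDT2001, Thm A (J. Amer. Math. Soc. 14)] -/
def RatBaseChangeModularity : Prop :=
  ∀ (K : Type) [Field K] [NumberField K] [IsTotallyReal K] (E₀ : WeierstrassCurve ℤ), E₀.Δ ≠ 0 →
    IsModularEllipticCurve K (E₀.baseChange (𝓞 K))

/-- DBC restricts to the tree's named fact on solvable Galois totally real fields (the leaf EXTENDS a held fact). -/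
theorem ratBaseChange_solvable_case (h : RatBaseChangeModularity) :
    isModularEllipticCurve_baseChange_rat_of_isSolvable :=
  fun K _ _ _ _ _ E₀ hΔ => h K E₀ hΔ

/-- `[ℚ(j) : ℚ] ≤ 1` means `j ∈ ℚ`. [folklore] -/
theorem exists_ratCast_eq_of_jDeg_le_one (K₀ : Type) [Field K₀] [NumberField K₀]
    (E : WeierstrassCurve (𝓞 K₀)) (h : jDeg K₀ E ≤ 1) : ∃ q : ℚ, (q : K₀) = jInv K₀ E := by
  have h1 : Module.finrank ℚ ℚ⟮jInv K₀ E⟯ = 1 := le_antisymm h Module.finrank_pos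
  have hb : ℚ⟮jInv K₀ E⟯ = ⊥ := IntermediateField.finrank_eq_one_iff.mp h1
  have hj : jInv K₀ E ∈ (⊥ : IntermediateField ℚ K₀) := by
    rw [← hb]; exact IntermediateField.mem_adjoin_simple_self ℚ _
  rw [IntermediateField.mem_bot] at hj
  obtain ⟨q, hq⟩ := hj
  exact ⟨q, by simpa using hq⟩

/-- Over ANY totally real `K`: DBC ⇒ every integral `E / 𝓞 K` with rational `j`-invariant is modular — CM if
`j ∈ {0, 1728}` (PROVED `WeierstrassCurve.HasCM.of_j_eq_zero_or_1728`), else a quadratic twist of the base change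
of the `ℤ`-model `ratJModel` (twist invariance = the PROVED `isModularEllipticCurve_of_jInvariant_eq_holds`).
Template: `isModularEllipticCurve_of_jInvariant_eq_ratCast` with the solvability binders gone. -/
theorem isModularEllipticCurve_of_jInv_eq_ratCast_pointwise
    (K : Type) [Field K] [NumberField K] [IsTotallyReal K]
    (hBC : ∀ E₀ : WeierstrassCurve ℤ, E₀.Δ ≠ 0 → IsModularEllipticCurve K (E₀.baseChange (𝓞 K)))
    (E : WeierstrassCurve (𝓞 K)) (hΔ : E.Δ ≠ 0)
    (j₀ : ℚ) (hj : jInv K E = (j₀ : K)) : IsModularEllipticCurve K E := by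
  by_cases h01 : j₀ = 0 ∨ j₀ = 1728
  · haveI hW : (E.baseChange K).IsElliptic := isElliptic_baseChange_of_Δ_ne_zero hΔ
    have hjE : (E.baseChange K).j = (j₀ : K) := (j_baseChange_eq_c₄_pow_div hΔ).trans hj
    refine Or.inl (WeierstrassCurve.HasCM.of_j_eq_zero_or_1728 ?_)
    rcases h01 with h | h
    · exact Or.inl (by rw [hjE, h, Rat.cast_zero])
    · exact Or.inr (by rw [hjE, h]; push_cast; rfl)
  push Not at h01
  obtain ⟨hj₀, hj₁⟩ := h01
  set p : ℤ := j₀.num with hp_def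
  set q : ℤ := (j₀.den : ℤ) with hq_def
  have hq : q ≠ 0 := by rw [hq_def]; exact_mod_cast j₀.den_nz
  have hp : p ≠ 0 := Rat.num_ne_zero.2 hj₀
  have hpq : p ≠ 1728 * q := by
    intro h
    apply hj₁
    have hq' : (j₀.den : ℚ) ≠ 0 := by exact_mod_cast j₀.den_nz
    calc j₀ = (j₀.num : ℚ) / j₀.den := (Rat.num_div_den j₀).symm
      _ = ((1728 * (j₀.den : ℤ) : ℤ) : ℚ) / j₀.den := by
          rw [show j₀.num = 1728 * (j₀.den : ℤ) from h]
      _ = 1728 := by push_cast; field_simp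
  have hE₀ : (ratJModel p q).Δ ≠ 0 := ratJModel_Δ_ne_zero hp hq hpq
  have hmod : IsModularEllipticCurve K ((ratJModel p q).baseChange (𝓞 K)) := hBC (ratJModel p q) hE₀
  have hj' : (algebraMap (𝓞 K) K ((ratJModel p q).baseChange (𝓞 K)).c₄) ^ 3 /
      algebraMap (𝓞 K) K ((ratJModel p q).baseChange (𝓞 K)).Δ = (j₀ : K) := by
    simp only [WeierstrassCurve.baseChange, WeierstrassCurve.map_c₄, WeierstrassCurve.map_Δ,
      eq_intCast, map_intCast]
    rw [ratJModel_c₄_pow_three_div_Δ hp hq hpq K, hp_def, hq_def, Int.cast_natCast, Rat.cast_def]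
  have hΔ₀ : ((ratJModel p q).baseChange (𝓞 K)).Δ ≠ 0 := by
    simp only [WeierstrassCurve.baseChange, WeierstrassCurve.map_Δ, eq_intCast]
    exact_mod_cast hE₀
  refine isModularEllipticCurve_of_jInvariant_eq_holds K ((ratJModel p q).baseChange (𝓞 K)) E hΔ₀ hΔ
    (hj'.trans hj.symm) ?_ ?_ hmod
  · rw [hj']; exact_mod_cast hj₀
  · rw [hj']; exact_mod_cast hj₁

/-- The same with the global leaf DBC. -/
theorem isModularEllipticCurve_of_jInv_eq_ratCast (hBC : RatBaseChangeModularity)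
    (K : Type) [Field K] [NumberField K] [IsTotallyReal K] (E : WeierstrassCurve (𝓞 K)) (hΔ : E.Δ ≠ 0)
    (j₀ : ℚ) (hj : jInv K E = (j₀ : K)) : IsModularEllipticCurve K E :=
  isModularEllipticCurve_of_jInv_eq_ratCast_pointwise K (fun E₀ h => hBC K E₀ h) E hΔ j₀ hj

/-- KERNEL: DBC ⇒ RJD. -/
theorem rationalJDoor_of_ratBaseChange (hBC : RatBaseChangeModularity) : RationalJDoor := by
  intro K₀ _ _ hbox E hΔ hdeg
  haveI : IsTotallyReal K₀ := hbox.1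
  obtain ⟨j₀, hj₀⟩ := exists_ratCast_eq_of_jDeg_le_one K₀ E hdeg
  exact isModularEllipticCurve_of_jInv_eq_ratCast hBC K₀ E hΔ j₀ hj₀.symm

/-! ## §4 The bridge: NSBC (base change from small totally real fields into the box) -/

/-- NSBC (bridge leaf; WEAKER; NEW — no print as typed): for an unanchored totally real `K₀` of degree `≥ 6`, a
totally real field `F` of degree `2`, `3` or `4` mapping to `K₀`, and an integral `E₀ / 𝓞 F` (`Δ ≠ 0`) that is
automorphic of weight zero over `F` (`IsAutomorphicOfWeightZero`, the conclusion of `FLS2015_theorem1` /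
`DNS2020_theorem4` / `Box2022_theorem1_1`), the base change `E₀ ⊗ 𝓞 K₀` is modular over `K₀`.  VERBATIM the tree fact
`isModularEllipticCurve_baseChange_of_isSolvable_of_isAutomorphicOfWeightZero` (Thorne 2016 Lemma 7.1 /
Langlands 1980) with the binders `[IsGalois F K] [IsSolvable (K ≃ₐ[F] K)]` deleted, `K` pinned to the REST box and
`[F:ℚ] ∈ {2, 3, 4}`: the Galois-soluble sub-locus is that fact (`smallFieldBaseChange_soluble_locus`); the INSOLUBLE
locus (e.g. `K₀` octic over a real quadratic `F` with relative Galois closure of group `S₄`, or `[K₀:F] ≥ 5` with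
closure `A₅`/`S₅`) is base change of Hilbert newforms over `F ≠ ℚ` along NON-solvable extensions — in print only for `F = ℚ` (Dieulefait 2012, Thm 1.2) and programme-level over real
quadratic `F` (Dieulefait–Pacetti-type safe chains).  REST_E ⇒ NSBC (`smallFieldBaseChange_of_restE`).
[ref: Thorne2016, Lemma 7.1] [ref: Dieulefait2015, Thm 1.2 and §5 (arXiv:1208.3946)] -/
def SmallFieldBaseChange : Prop :=
  ∀ (K₀ : Type) [Field K₀] [NumberField K₀], UnanchoredBox K₀ →
    ∀ (F : Type) [Field F] [NumberField F] [IsTotallyReal F] [Algebra F K₀],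
      2 ≤ Module.finrank ℚ F → Module.finrank ℚ F ≤ 4 →
      ∀ E₀ : WeierstrassCurve (𝓞 F), E₀.Δ ≠ 0 → IsAutomorphicOfWeightZero E₀ →
        IsModularEllipticCurve K₀ (E₀.baseChange (𝓞 K₀))

/-- Reading `c₄`, `Δ` of `E₀ ⊗ 𝓞 K` in `K` through `F`. [folklore] -/
theorem algebraMap_baseChange_c₄ (F K : Type) [Field F] [NumberField F] [Field K] [NumberField K] [Algebra F K]
    (E₀ : WeierstrassCurve (𝓞 F)) :
    algebraMap (𝓞 K) K (E₀.baseChange (𝓞 K)).c₄ = algebraMap F K (algebraMap (𝓞 F) F E₀.c₄) := by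
  rw [WeierstrassCurve.baseChange, WeierstrassCurve.map_c₄, ← IsScalarTower.algebraMap_apply,
    ← IsScalarTower.algebraMap_apply]

/-- The discriminant of the base change `E₀.baseChange (𝓞 K)` is the image of `E₀.Δ` under `𝓞 F → 𝓞 K → K`. -/
theorem algebraMap_baseChange_Δ (F K : Type) [Field F] [NumberField F] [Field K] [NumberField K] [Algebra F K]
    (E₀ : WeierstrassCurve (𝓞 F)) :
    algebraMap (𝓞 K) K (E₀.baseChange (𝓞 K)).Δ = algebraMap F K (algebraMap (𝓞 F) F E₀.Δ) := by
  rw [WeierstrassCurve.baseChange, WeierstrassCurve.map_Δ, ← IsScalarTower.algebraMap_apply,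
    ← IsScalarTower.algebraMap_apply]

/-- `Δ(E₀ ⊗ 𝓞 K) ≠ 0` when `Δ(E₀) ≠ 0`. [folklore] -/
theorem baseChange_Δ_ne_zero (F K : Type) [Field F] [NumberField F] [Field K] [NumberField K] [Algebra F K]
    (E₀ : WeierstrassCurve (𝓞 F)) (hΔ₀ : E₀.Δ ≠ 0) : (E₀.baseChange (𝓞 K)).Δ ≠ 0 := by
  intro h
  have h' : algebraMap F K (algebraMap (𝓞 F) F E₀.Δ) = 0 := by rw [← algebraMap_baseChange_Δ, h, map_zero]
  exact hΔ₀ ((FaithfulSMul.algebraMap_injective (𝓞 F) F)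
    (((algebraMap F K).injective) (h'.trans (map_zero _).symm) |>.trans (map_zero _).symm))

/-- The `j`-invariant of a base change `E₀ ⊗ 𝓞 K` read in `K` is the image of `j(E₀) ∈ F`. [folklore] -/
theorem jInv_baseChange (F K : Type) [Field F] [NumberField F] [Field K] [NumberField K] [Algebra F K]
    (E₀ : WeierstrassCurve (𝓞 F)) :
    jInv K (E₀.baseChange (𝓞 K)) = algebraMap F K ((algebraMap (𝓞 F) F E₀.c₄) ^ 3 / algebraMap (𝓞 F) F E₀.Δ) := by
  rw [jInv, algebraMap_baseChange_c₄, algebraMap_baseChange_Δ, ← map_pow, ← map_div₀]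

/-- NECESSITY: REST_E ⇒ NSBC (a base change into the box is an integral curve over a box field). -/
theorem smallFieldBaseChange_of_restE (h : UnanchoredHighDegreeModularE) : SmallFieldBaseChange := by
  rw [modularE_iff_box] at h
  intro K₀ _ _ hbox F _ _ _ _ _ _ E₀ hΔ₀ _
  exact h K₀ hbox _ (baseChange_Δ_ne_zero F K₀ E₀ hΔ₀)

/-- PRINT SUB-LOCUS: on pairs `F → K₀` with `K₀ / F` Galois and solvable, NSBC is the tree's named fact
`isModularEllipticCurve_baseChange_of_isSolvable_of_isAutomorphicOfWeightZero` (Thorne 2016, Lemma 7.1) BY NAME. -/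
theorem smallFieldBaseChange_soluble_locus
    (h : isModularEllipticCurve_baseChange_of_isSolvable_of_isAutomorphicOfWeightZero)
    (K₀ : Type) [Field K₀] [NumberField K₀] (hbox : UnanchoredBox K₀)
    (F : Type) [Field F] [NumberField F] [IsTotallyReal F] [Algebra F K₀] [IsGalois F K₀]
    [IsSolvable (K₀ ≃ₐ[F] K₀)] (E₀ : WeierstrassCurve (𝓞 F)) (hΔ₀ : E₀.Δ ≠ 0)
    (haut : IsAutomorphicOfWeightZero E₀) : IsModularEllipticCurve K₀ (E₀.baseChange (𝓞 K₀)) := by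
  haveI : IsTotallyReal K₀ := hbox.1
  exact h F K₀ E₀ hΔ₀ haut

/-! ### The integral model of `j`-invariant `p/q` over a commutative ring (as in `SqrtFiveQuarticCovers…`) -/

section jModel

variable {R : Type*} [CommRing R] (p q : R)

/-- The model `y² = x³ + 3p(1728q − p)q²·x + 2p(1728q − p)²q³` of `j`-invariant `p/q`. -/
def jModel : WeierstrassCurve R := ⟨0, 0, 0, 3 * p * (1728 * q - p) * q ^ 2, 2 * p * (1728 * q - p) ^ 2 * q ^ 3⟩

/-- `c₄ = -144·p(1728q − p)q²`. [folklore] -/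
theorem jModel_c₄ : (jModel p q).c₄ = -144 * p * (1728 * q - p) * q ^ 2 := by
  simp only [jModel, WeierstrassCurve.c₄, WeierstrassCurve.b₂, WeierstrassCurve.b₄]
  ring

/-- `Δ = -2985984·p²(1728q − p)³q⁷`. [folklore] -/
theorem jModel_Δ : (jModel p q).Δ = -2985984 * p ^ 2 * (1728 * q - p) ^ 3 * q ^ 7 := by
  simp only [jModel, WeierstrassCurve.Δ, WeierstrassCurve.b₂, WeierstrassCurve.b₄, WeierstrassCurve.b₆,
    WeierstrassCurve.b₈]
  ring

/-- `c₄³ · q = p · Δ` (so `j = p/q`). [folklore] -/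
theorem jModel_c₄_pow_three_mul : (jModel p q).c₄ ^ 3 * q = p * (jModel p q).Δ := by
  rw [jModel_c₄, jModel_Δ]
  ring

/-- `Δ ≠ 0` when `p ≠ 0`, `q ≠ 0`, `p ≠ 1728 q` in a characteristic-zero domain. [folklore] -/
theorem jModel_Δ_ne_zero [IsDomain R] [CharZero R] {p q : R} (hp : p ≠ 0) (hq : q ≠ 0)
    (hpq : p ≠ 1728 * q) : (jModel p q).Δ ≠ 0 := by
  rw [jModel_Δ]
  have h : 1728 * q - p ≠ 0 := sub_ne_zero.2 (Ne.symm hpq)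
  simp [h, hp, hq]

end jModel

end Summit.Langlands.Langlands.Theorems.JDegreeFilterSplit
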